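import Literature.AlgebraicGeometry.AbelianSchemes.TupleIsoPointCriteria          -- ★ `exists_iso_of_tupleRel_id` (the converse of Layer A)
import Literature.AlgebraicGeometry.AbelianSchemes.TupleIsoAtOfFibreIsoPoints      -- ★ `inv_comp_lam_comp_dualIsogenyOver_inv_of_eq`, `sectionBaseChange_left_eq_restrictPt_left`
import Literature.AlgebraicGeometry.AbelianSchemes.IsogenyRoofTransportAlongIso    -- ★ `map_inv_map_hom` (points along an iso)
import Literature.AlgebraicGeometry.AbelianSchemes.LevelStructureOfIsogeny         -- ★ `LevelStructure.section_of_σ_comp`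
import HarnessLib

/-!
# An MFK isomorphism `(G, Ĝ)` of two PEL tuples at a field point IS a group isomorphism exact on `λ` (both ways), on `ι` (both ways)
# and on the LEVEL POINTS `σᵃ(t)` (both ways) — the bridge from `TupleIsoVia`∕`TupleIsoAt₂` to the transport cores

Topic `AlgebraicGeometry/AbelianSchemes`; namespace `Literature.AlgebraicGeometry.AbelianSchemes.AbelianSchemeOver`.  THEOREMS ONLY (no definition, no
named fact, no instance, no notation, no `sorry`).  Cell `hodgecm-mathlib` (D-0151), P6 «MOD programme», half A line L4, E-readings leaf
`Lines/F0_P6a_EReadings.lean` (LA4-plan (g0)), sockets `stub_HECKETRANS` ∕ `stub_COVERTRANS` (LEAD «M-55b» (3)): their per-point cores ★ p847813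
`roof_transport_along_iso` and ★ p847952 `cover_transport_along_iso` take two isomorphisms of group schemes over `Spec Ω` EXACT on `λ` in
dual-homomorphism form (`e ≫ λ₂ ≫ e^∨ = λ₁`), on the endomorphism families (`ι₁(a) ≫ e = e ≫ ι₂(a)`) and on the chosen `Ω`-POINTS (`e(σ₁ᵃ) = σ₂ᵃ`),
whereas the provenance `gen_iso : TupleIsoAt₂ …` of the P-line carrier `PELSpreadAt` (SP3-a2 `Lines/F0_P6a_IsomSchemeFiniteType` :67∕:89) delivers the
UNBUNDLED five clauses of [MumfordFogartyKirwan1994] Def. 7.2–7.3 along `𝟙 (Spec Ω)` via `(G, Ĝ)` (level ∕ `X`, `X̂`, Poincaré, `λ`, `𝒪`-action) between the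
base changes `𝒜ᵢ ×_Y Spec Ω` of two tuples over `Y`.  This file is THE ONE BRIDGE both assemblies consume (seat LA4-p01 (g0), DEAL v2;
`--supports stmt-HodgeConjecture-24832`, count-neutral).  HONEST LABEL: HC_CM is proved only modulo the 2 remaining named inputs (hLiu418 24832,
h413 24833) until rung 0 closes; nothing here is about HC.

* §1 **`map_restrictPt_section_eq_of_baseChange_σ_comp`** — LEVEL SECTIONS ⇒ LEVEL POINTS: for two tuples `(𝒜ᵢ, φᵢ)` over `Y`, a field point
  `t : Spec K → Y` and a homomorphism `f : 𝒜₁ ×_Y t → 𝒜₂ ×_Y t` carrying the pulled-back basis sections (`(φ₁ ×_Y t)ᵢ ≫ f = (φ₂ ×_Y t)ᵢ`), `f` carries the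
  points `σᵃ(t)` (★ `restrictPt` of ★ `section_`) for ALL `a` (`σᵃ = ∏ σᵢ^{aᵢ}`, ★ `LevelStructure.section_of_σ_comp`, ★ `sectionBaseChange_sectionPow`,
  ★ `sectionBaseChange_left_eq_restrictPt_left`) — the converse of ★ `baseChange_σ_comp_eq_of_map_restrictPt_section_eq`.
* §2 **`exists_iso_exact_of_tupleRel_id_point`** — THE BRIDGE: from the five clauses at `t` (the body of `TupleIsoVia t …`, VERBATIM) an isomorphism
  `e : (𝒜₁ ×_Y t).X ≅ (𝒜₂ ×_Y t).X` of group schemes with `e.hom.left = G` and, IN BOTH ORIENTATIONS, `λ`-exactness in dual-homomorphism form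
  (`e ≫ λ₂ ≫ e^∨ = λ₁`, `e⁻¹ ≫ λ₁ ≫ (e⁻¹)^∨ = λ₂`), `ι`-equivariance and the correspondence of the level points `σᵃ(t)` — ★ `exists_iso_of_tupleRel_id`
  ([MilneAV2008] I §8 «unique»: `Ĝ = Ĥ_e`), ★ `inv_comp_lam_comp_dualIsogenyOver_inv_of_eq`, §1, ★ `map_inv_map_hom`.  The unit clause `𝒫₂|_{A₂ × {ε}} ≅ 𝒪`
  is automatic (★ `Polarization.nonempty_unitHatSlice_iso`).

## References
* [MumfordFogartyKirwan1994] D. Mumford, J. Fogarty, F. Kirwan, *Geometric Invariant Theory*, 3rd ed. (1994), Ch. 7 §2 Def. 7.1 (p. 129), Def. 7.2 (p. 129),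
  Def. 7.3 (p. 130).
* [MilneAV2008] J. S. Milne, *Abelian Varieties* (2008), I §8 pp. 36–37, I §9 Thm. 9.1 (p. 42).
* [MumfordAV1970] D. Mumford, *Abelian Varieties* (1970), §15 Thm. 1 (p. 143).
* [Milne2005ShimuraVarieties] J. S. Milne, *Introduction to Shimura varieties* (2005), §14 pp. 124–125 («`σ(A, i, λ, ηK)`»).
-/

set_option autoImplicit false

noncomputable section

-- Mathlib's `Over`/pull-back API is stated across semireducible wrappers (as in the ★ `AbelianSchemes/*` files).
set_option backward.isDefEq.respectTransparency false

universe u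

open CategoryTheory CategoryTheory.Limits AlgebraicGeometry MonoidalCategory
open scoped MonObj

namespace Literature.AlgebraicGeometry.AbelianSchemes

namespace AbelianSchemeOver

open Literature.AlgebraicGeometry.Motives (AlgPoints)

/-! ### §1 Level SECTIONS carried ⇒ level POINTS `σᵃ(t)` carried -/

section Points

variable {Y : Scheme.{u}} {K : Type u} [Field K] {A₁ A₂ : AbelianSchemeOver Y} (t : Spec (.of K) ⟶ Y)
  {g n : ℕ} (φ₁ : A₁.LevelStructure g n) (φ₂ : A₂.LevelStructure g n)

/-- **From level SECTIONS to level POINTS**: a homomorphism `f : 𝒜₁ ×_Y t → 𝒜₂ ×_Y t` carrying the pulled-back basis sections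
`(φ₁ ×_Y t)ᵢ ≫ f = (φ₂ ×_Y t)ᵢ` carries the `Ω`-points `σᵃ(t)` for all `a ∈ (ℤ∕n)^{2g}`: `f(φ₁ᵃ(t)) = φ₂ᵃ(t)` (★ `restrictPt` of ★ `section_`).
[cite: MumfordFogartyKirwan1994, Ch. 7 §2 Definition 7.1 (p. 129) and Definition 7.3 (p. 130)] -/
theorem map_restrictPt_section_eq_of_baseChange_σ_comp (f : (A₁.baseChange t).X ⟶ (A₂.baseChange t).X) [IsMonHom f]
    (h : ∀ i, (φ₁.baseChange t).σ i ≫ f = (φ₂.baseChange t).σ i) (a : Fin g ⊕ Fin g → ZMod n) :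
    AlgPoints.map f (A₁.restrictPt t (φ₁.section_ a)) = A₂.restrictPt t (φ₂.section_ a) := by
  -- the induced sections: `(φ₂ ×_Y t)(a) = (φ₁ ×_Y t)(a) ≫ f`
  have hs : (φ₂.baseChange t).section_ a = (φ₁.baseChange t).section_ a ≫ f :=
    LevelStructure.section_of_σ_comp (fun i => (h i).symm) a
  -- `(φ ×_Y t)(a) = φ(a) ×_Y t`
  have hb₁ : (φ₁.baseChange t).section_ a = A₁.sectionBaseChange t (φ₁.section_ a) := by
    rw [LevelStructure.section_, LevelStructure.section_, sectionBaseChange_sectionPow]; rfl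
  have hb₂ : (φ₂.baseChange t).section_ a = A₂.sectionBaseChange t (φ₂.section_ a) := by
    rw [LevelStructure.section_, LevelStructure.section_, sectionBaseChange_sectionPow]; rfl
  rw [hb₁, hb₂] at hs
  apply Over.OverMorphism.ext
  change (A₁.restrictPt t (φ₁.section_ a)).left ≫ f.left = (A₂.restrictPt t (φ₂.section_ a)).left
  rw [← sectionBaseChange_left_eq_restrictPt_left, ← sectionBaseChange_left_eq_restrictPt_left, hs, Over.comp_left]

end Points

/-! ### §2 THE BRIDGE: the five clauses at a field point ⇒ a group isomorphism exact on `λ`, `ι` and the level points, both ways -/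

section Bridge

variable {Y : Scheme.{u}} {K : Type u} [Field K] (t : Spec (.of K) ⟶ Y)
  (𝒜₁ 𝒜₂ : AbelianSchemeOver Y) {O : Type*} [CommRing O] (ρ₁ : RingAction O 𝒜₁) (ρ₂ : RingAction O 𝒜₂)
  (D₁ : 𝒜₁.DualPair) (D₂ : 𝒜₂.DualPair) (pol₁ : 𝒜₁.Polarization D₁) (pol₂ : 𝒜₂.Polarization D₂)
  {g n : ℕ} (lvl₁ : 𝒜₁.LevelStructure g n) (lvl₂ : 𝒜₂.LevelStructure g n)

/-- **THE BRIDGE `(G, Ĝ)` ⇒ `e`.**  At a field point `t : Spec K → Y`, the five clauses of [MumfordFogartyKirwan1994] Def. 7.2–7.3 along `𝟙 (Spec K)`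
between `(𝒜₁, ι₁, (Â₁, 𝒫₁), λ₁, φ₁) ×_Y t` and `(𝒜₂, ι₂, (Â₂, 𝒫₂), λ₂, φ₂) ×_Y t` via `(G, Ĝ)` — the body of the SP3-a2 letter `TupleIsoVia t …` VERBATIM —
yield an isomorphism of group schemes `e : (𝒜₁ ×_Y t) ≅ (𝒜₂ ×_Y t)` with `e.hom.left = G` which, IN BOTH ORIENTATIONS, is exact on the polarisations in
dual-homomorphism form, intertwines the actions, and carries the level points `σᵃ(t)`: exactly the hypotheses `he∕hact∕hpt` of ★ `roof_transport_along_iso`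
and ★ `cover_transport_along_iso` (read with `e` or with `e.symm`). [cite: MumfordFogartyKirwan1994, Ch. 7 §2 Definition 7.2 (p. 129) and Definition 7.3 (p. 130)]
[cite: MilneAV2008, I §8 pp. 36–37] [cite: MumfordAV1970, §15 Thm. 1 (p. 143)] [cite: Milne2005ShimuraVarieties, §14 pp. 124–125] -/
theorem exists_iso_exact_of_tupleRel_id_point
    {G : (𝒜₁.baseChange t).X.left ⟶ (𝒜₂.baseChange t).X.left} {Ĝ : (D₁.baseChange t).hat.X.left ⟶ (D₂.baseChange t).hat.X.left}
    (h : (lvl₁.baseChange t).IsBaseChangeVia (lvl₂.baseChange t) (𝟙 _) G ∧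
      (D₁.baseChange t).hat.IsBaseChangeVia (D₂.baseChange t).hat (𝟙 _) Ĝ ∧
      (∃ (wG : (𝒜₁.baseChange t).X.hom ≫ 𝟙 _ = G ≫ (𝒜₂.baseChange t).X.hom)
          (wĜ : (D₁.baseChange t).hat.X.hom ≫ 𝟙 _ = Ĝ ≫ (D₂.baseChange t).hat.X.hom),
        Nonempty ((Scheme.Modules.pullback
            (pullback.map (𝒜₁.baseChange t).X.hom (D₁.baseChange t).hat.X.hom
              (𝒜₂.baseChange t).X.hom (D₂.baseChange t).hat.X.hom G Ĝ (𝟙 _) wG wĜ)).obj (D₂.baseChange t).P ≅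
          (D₁.baseChange t).P)) ∧
      (pol₁.baseChange t).lam.left ≫ Ĝ = G ≫ (pol₂.baseChange t).lam.left ∧
      ∀ a : O, (baseChangeHom (ρ₁.i a) t).left ≫ G = G ≫ (baseChangeHom (ρ₂.i a) t).left) :
    ∃ (e : (𝒜₁.baseChange t).X ≅ (𝒜₂.baseChange t).X) (_ : IsMonHom e.hom), e.hom.left = G ∧
      e.hom ≫ (pol₂.baseChange t).lam ≫ DualPair.dualIsogenyOver e.hom (D₁.baseChange t) (D₂.baseChange t) = (pol₁.baseChange t).lam ∧
      e.inv ≫ (pol₁.baseChange t).lam ≫ DualPair.dualIsogenyOver e.inv (D₂.baseChange t) (D₁.baseChange t) = (pol₂.baseChange t).lam ∧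
      (∀ a, baseChangeHom (ρ₁.i a) t ≫ e.hom = e.hom ≫ baseChangeHom (ρ₂.i a) t) ∧
      (∀ a, baseChangeHom (ρ₂.i a) t ≫ e.inv = e.inv ≫ baseChangeHom (ρ₁.i a) t) ∧
      (∀ a, AlgPoints.map e.hom (𝒜₁.restrictPt t (lvl₁.section_ a)) = 𝒜₂.restrictPt t (lvl₂.section_ a)) ∧
      (∀ a, AlgPoints.map e.inv (𝒜₂.restrictPt t (lvl₂.section_ a)) = 𝒜₁.restrictPt t (lvl₁.section_ a)) := by
  obtain ⟨e, hmon, hleft, -, hlam, hσ, hact⟩ := exists_iso_of_tupleRel_id (D₁.baseChange t) (D₂.baseChange t)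
    (pol₁.baseChange t).lam (pol₂.baseChange t).lam (pol₂.baseChange t).nonempty_unitHatSlice_iso (lvl₁.baseChange t) (lvl₂.baseChange t)
    (fun a => baseChangeHom (ρ₁.i a) t) (fun a => baseChangeHom (ρ₂.i a) t) h
  haveI := hmon
  have hpt : ∀ a, AlgPoints.map e.hom (𝒜₁.restrictPt t (lvl₁.section_ a)) = 𝒜₂.restrictPt t (lvl₂.section_ a) :=
    map_restrictPt_section_eq_of_baseChange_σ_comp t lvl₁ lvl₂ e.hom hσ
  refine ⟨e, hmon, hleft, hlam,
    inv_comp_lam_comp_dualIsogenyOver_inv_of_eq (D₁.baseChange t) (D₂.baseChange t) (pol₁.baseChange t).lam (pol₂.baseChange t).lam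
      (pol₂.baseChange t).nonempty_unitHatSlice_iso e hlam,
    hact, fun a => ?_, hpt, fun a => ?_⟩
  · rw [Iso.comp_inv_eq, Category.assoc, hact a, Iso.inv_hom_id_assoc]
  · rw [← hpt a, map_inv_map_hom]

end Bridge

/-! ### §3 (ED. 2) TWO FAMILIES OVER TWO BASES, read at two field points with a common residue field

ED. 2 («L4» LA4-p01 (g2), X-LEAF socket `stub_ECtoΩ` of `Lines/F0_P6a_EExports.lean`, LA4-plan (g0) DEAL #20′ (ii-b)): §1–§2 compare `𝒜₁ ×_Y t` and
`𝒜₂ ×_Y t` for ONE base `Y` and ONE point `t`; the transport of the E-readings along an isomorphism of point bases compares `𝒜 ×_X (e ≫ t)` with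
`(𝒜 ×_X Spec Ω) ×_Ω e` — i.e. `𝒜₁ := 𝒜` over `Y₁ := X` at `t₁ := e ≫ t` against `𝒜₂ := 𝒜 ×_X Spec Ω` over `Y₂ := Spec Ω` at `t₂ := e` (★
`tupleRel_baseChangeCompGrpIso_hom∕_inv` gives the five clauses).  The proofs are those of §1–§2 verbatim: nothing there used `Y₁ = Y₂` or `t₁ = t₂`.
ED. 1 bytes above are unchanged. -/

section TwoFamilies

variable {Y₁ Y₂ : Scheme.{u}} {K : Type u} [Field K] (t₁ : Spec (.of K) ⟶ Y₁) (t₂ : Spec (.of K) ⟶ Y₂)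
  (𝒜₁ : AbelianSchemeOver Y₁) (𝒜₂ : AbelianSchemeOver Y₂) {O : Type*} [CommRing O] (ρ₁ : RingAction O 𝒜₁) (ρ₂ : RingAction O 𝒜₂)
  (D₁ : 𝒜₁.DualPair) (D₂ : 𝒜₂.DualPair) (pol₁ : 𝒜₁.Polarization D₁) (pol₂ : 𝒜₂.Polarization D₂)
  {g n : ℕ} (lvl₁ : 𝒜₁.LevelStructure g n) (lvl₂ : 𝒜₂.LevelStructure g n)

/-- (ED. 2) **From level SECTIONS to level POINTS, two families**: a homomorphism `f : 𝒜₁ ×_{Y₁} t₁ → 𝒜₂ ×_{Y₂} t₂` carrying the pulled-back basis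
sections carries the `Ω`-points `σᵃ(tᵢ)`: `f(φ₁ᵃ(t₁)) = φ₂ᵃ(t₂)`. [cite: MumfordFogartyKirwan1994, Ch. 7 §2 Definition 7.1 (p. 129) and Definition 7.3 (p. 130)] -/
theorem map_restrictPt_section_eq_of_baseChange_σ_comp₂ (f : (𝒜₁.baseChange t₁).X ⟶ (𝒜₂.baseChange t₂).X) [IsMonHom f]
    (h : ∀ i, (lvl₁.baseChange t₁).σ i ≫ f = (lvl₂.baseChange t₂).σ i) (a : Fin g ⊕ Fin g → ZMod n) :
    AlgPoints.map f (𝒜₁.restrictPt t₁ (lvl₁.section_ a)) = 𝒜₂.restrictPt t₂ (lvl₂.section_ a) := by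
  have hs : (lvl₂.baseChange t₂).section_ a = (lvl₁.baseChange t₁).section_ a ≫ f :=
    LevelStructure.section_of_σ_comp (fun i => (h i).symm) a
  have hb₁ : (lvl₁.baseChange t₁).section_ a = 𝒜₁.sectionBaseChange t₁ (lvl₁.section_ a) := by
    rw [LevelStructure.section_, LevelStructure.section_, sectionBaseChange_sectionPow]; rfl
  have hb₂ : (lvl₂.baseChange t₂).section_ a = 𝒜₂.sectionBaseChange t₂ (lvl₂.section_ a) := by
    rw [LevelStructure.section_, LevelStructure.section_, sectionBaseChange_sectionPow]; rfl
  rw [hb₁, hb₂] at hs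
  apply Over.OverMorphism.ext
  change (𝒜₁.restrictPt t₁ (lvl₁.section_ a)).left ≫ f.left = (𝒜₂.restrictPt t₂ (lvl₂.section_ a)).left
  rw [← sectionBaseChange_left_eq_restrictPt_left, ← sectionBaseChange_left_eq_restrictPt_left, hs, Over.comp_left]

/-- (ED. 2) **THE BRIDGE `(G, Ĝ)` ⇒ `e`, TWO FAMILIES.**  At field points `t₁ : Spec K → Y₁`, `t₂ : Spec K → Y₂` with the same `K`, the five clauses of
[MumfordFogartyKirwan1994] Def. 7.2–7.3 along `𝟙 (Spec K)` between `(𝒜₁, ι₁, (Â₁, 𝒫₁), λ₁, φ₁) ×_{Y₁} t₁` and `(𝒜₂, ι₂, (Â₂, 𝒫₂), λ₂, φ₂) ×_{Y₂} t₂` via `(G, Ĝ)`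
yield an isomorphism of group schemes `e : 𝒜₁ ×_{Y₁} t₁ ≅ 𝒜₂ ×_{Y₂} t₂` with `e.hom.left = G` exact on the polarisations (dual-homomorphism form, both
orientations), intertwining the actions and carrying the level points `σᵃ(t₁) ↦ σᵃ(t₂)` — the hypotheses `he∕hact∕hpt` of ★ `roof_transport_along_iso` ∕
★ `cover_transport_along_iso`.  Instance of record (X-LEAF `stub_ECtoΩ`): `(Y₁, t₁, 𝒜₁) := (X, e ≫ t, 𝒜)`, `(Y₂, t₂, 𝒜₂) := (Spec Ω, e, 𝒜 ×_X t)` fed by ★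
`tupleRel_baseChangeCompGrpIso_hom`. [cite: MumfordFogartyKirwan1994, Ch. 7 §2 Definition 7.2 (p. 129) and Definition 7.3 (p. 130)] [cite: MilneAV2008, I §8 pp. 36–37]
[cite: MumfordAV1970, §15 Thm. 1 (p. 143)] [cite: Milne2005ShimuraVarieties, §14 pp. 124–125] -/
theorem exists_iso_exact_of_tupleRel_id_point₂
    {G : (𝒜₁.baseChange t₁).X.left ⟶ (𝒜₂.baseChange t₂).X.left} {Ĝ : (D₁.baseChange t₁).hat.X.left ⟶ (D₂.baseChange t₂).hat.X.left}
    (h : (lvl₁.baseChange t₁).IsBaseChangeVia (lvl₂.baseChange t₂) (𝟙 _) G ∧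
      (D₁.baseChange t₁).hat.IsBaseChangeVia (D₂.baseChange t₂).hat (𝟙 _) Ĝ ∧
      (∃ (wG : (𝒜₁.baseChange t₁).X.hom ≫ 𝟙 _ = G ≫ (𝒜₂.baseChange t₂).X.hom)
          (wĜ : (D₁.baseChange t₁).hat.X.hom ≫ 𝟙 _ = Ĝ ≫ (D₂.baseChange t₂).hat.X.hom),
        Nonempty ((Scheme.Modules.pullback
            (pullback.map (𝒜₁.baseChange t₁).X.hom (D₁.baseChange t₁).hat.X.hom
              (𝒜₂.baseChange t₂).X.hom (D₂.baseChange t₂).hat.X.hom G Ĝ (𝟙 _) wG wĜ)).obj (D₂.baseChange t₂).P ≅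
          (D₁.baseChange t₁).P)) ∧
      (pol₁.baseChange t₁).lam.left ≫ Ĝ = G ≫ (pol₂.baseChange t₂).lam.left ∧
      ∀ a : O, (baseChangeHom (ρ₁.i a) t₁).left ≫ G = G ≫ (baseChangeHom (ρ₂.i a) t₂).left) :
    ∃ (e : (𝒜₁.baseChange t₁).X ≅ (𝒜₂.baseChange t₂).X) (_ : IsMonHom e.hom), e.hom.left = G ∧
      e.hom ≫ (pol₂.baseChange t₂).lam ≫ DualPair.dualIsogenyOver e.hom (D₁.baseChange t₁) (D₂.baseChange t₂) = (pol₁.baseChange t₁).lam ∧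
      e.inv ≫ (pol₁.baseChange t₁).lam ≫ DualPair.dualIsogenyOver e.inv (D₂.baseChange t₂) (D₁.baseChange t₁) = (pol₂.baseChange t₂).lam ∧
      (∀ a, baseChangeHom (ρ₁.i a) t₁ ≫ e.hom = e.hom ≫ baseChangeHom (ρ₂.i a) t₂) ∧
      (∀ a, baseChangeHom (ρ₂.i a) t₂ ≫ e.inv = e.inv ≫ baseChangeHom (ρ₁.i a) t₁) ∧
      (∀ a, AlgPoints.map e.hom (𝒜₁.restrictPt t₁ (lvl₁.section_ a)) = 𝒜₂.restrictPt t₂ (lvl₂.section_ a)) ∧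
      (∀ a, AlgPoints.map e.inv (𝒜₂.restrictPt t₂ (lvl₂.section_ a)) = 𝒜₁.restrictPt t₁ (lvl₁.section_ a)) := by
  obtain ⟨e, hmon, hleft, -, hlam, hσ, hact⟩ := exists_iso_of_tupleRel_id (D₁.baseChange t₁) (D₂.baseChange t₂)
    (pol₁.baseChange t₁).lam (pol₂.baseChange t₂).lam (pol₂.baseChange t₂).nonempty_unitHatSlice_iso (lvl₁.baseChange t₁) (lvl₂.baseChange t₂)
    (fun a => baseChangeHom (ρ₁.i a) t₁) (fun a => baseChangeHom (ρ₂.i a) t₂) h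
  haveI := hmon
  have hpt : ∀ a, AlgPoints.map e.hom (𝒜₁.restrictPt t₁ (lvl₁.section_ a)) = 𝒜₂.restrictPt t₂ (lvl₂.section_ a) :=
    map_restrictPt_section_eq_of_baseChange_σ_comp₂ t₁ t₂ 𝒜₁ 𝒜₂ lvl₁ lvl₂ e.hom hσ
  refine ⟨e, hmon, hleft, hlam,
    inv_comp_lam_comp_dualIsogenyOver_inv_of_eq (D₁.baseChange t₁) (D₂.baseChange t₂) (pol₁.baseChange t₁).lam (pol₂.baseChange t₂).lam
      (pol₂.baseChange t₂).nonempty_unitHatSlice_iso e hlam,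
    hact, fun a => ?_, hpt, fun a => ?_⟩
  · rw [Iso.comp_inv_eq, Category.assoc, hact a, Iso.inv_hom_id_assoc]
  · rw [← hpt a, map_inv_map_hom]

end TwoFamilies

end AbelianSchemeOver

end Literature.AlgebraicGeometry.AbelianSchemes

end
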